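import Literature.NumberTheory.Sieve.DrappeauDispersion
import Literature.NumberTheory.Sieve.DrappeauTopacogullariProofs
import Literature.NumberTheory.Sieve.BombieriFriedlanderIwaniecDispersion
import Mathlib

/-!
# Type I₂ dilated, line `peel-to-drappeau`: arithmetic tools for THE WINDOW step (`stub_window`)

Support file (theorem-only) for `Summits/Parity/GeneralizedHardyLittlewood/Theorems/
LiouvilleShiftedTablesTypeI2DilatedWindow.lean`, which proves
`WindowStep : DilatedTypeIICore → DilatedTypeII` of the crux `TypeI2Dilated`
(route `LiouvilleShiftedTables`, line `peel-to-drappeau`): the hyperbolic window `Ylo < mn ≤ Yhi` is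
separated by archimedean characters (`Literature.NumberTheory.Sieve.LogWindow`), and the strips /
far error are bounded trivially.  This file holds the arithmetic pieces of that trivial bound which
do not mention the line's vocabulary:

* §2 `norm_uR_le`, `sum_norm_uR_le` — `|𝔲_{Rd}(k c̄; s)| ≤ 1_{s ∣ k − c} + Rd τ(s)²/s` and its
  sum over a block of moduli `s ∼ Slo` (Drappeau's kernel `Drappeau2017.uR`; the count of characters
  by conductor `DrappeauTopacogullari2019.card_filter_conductor_le`, `φ(s)⁻¹ ≤ τ(s)/s`);
* §3 sizes of dyadic boxes and of divisor-bounded coefficients (`norm_le_of_divisor_bound`: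
  `|α_m| ≤ σ₀(m)^K ⇒ |α_m| ≤ Ca^K X^ε`), `norm_mul_cpow_le` (`|α_m m^{iτ}| ≤ |α_m|`).

The numerical inequalities of the step are in the sibling `…TypeI2DilatedWindowNumerics.lean`.
No definitions, no named facts. [this line: peel-to-drappeau, stub_window]
-/

noncomputable section

namespace Summit.Parity.GeneralizedHardyLittlewood.Cruxes.TypeI2Dilated.PeelToDrappeau

open Finset Real
open scoped ArithmeticFunction.sigma Classical
open Literature.NumberTheory.Sieve Literature.NumberTheory.Sieve.Drappeau2017
open Literature.NumberTheory.Sieve.DrappeauTopacogullari2019 (card_filter_conductor_le totient_inv_le)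

/-! ### §2 The trivial bound for Drappeau's kernel `𝔲_R` -/

/-- **Trivial bound for `𝔲_R`**: for `s ≥ 1`, `(s, c) = 1`, `Rd ≥ 0` and an integer `k`,
`|𝔲_{Rd}(k c̄; s)| ≤ 1_{s ∣ k − c} + Rd τ(s)² / s` — from `𝔲_R = 1_{t = 1} − K_R`
(`mainKernel_add_uR_eq_ite`), `|χ(t)| ≤ 1`, `#{χ mod s : cond χ ≤ Rd} ≤ Rd τ(s)`
(`card_filter_conductor_le`) and `φ(s)⁻¹ ≤ τ(s)/s` (`totient_inv_le`). [folklore] -/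
theorem norm_uR_le {Rd : ℝ} (hRd : 0 ≤ Rd) {s : ℕ} (hs : 0 < s) {c : ℤ} (hsc : IsCoprime (s : ℤ) c)
    (k : ℤ) :
    ‖uR Rd s ((k : ZMod s) * ((c : ZMod s))⁻¹)‖ ≤
      (if (s : ℤ) ∣ k - c then 1 else 0) + Rd * ((Nat.divisors s).card : ℝ) ^ 2 / s := by
  haveI : NeZero s := ⟨hs.ne'⟩
  set t : ZMod s := (k : ZMod s) * ((c : ZMod s))⁻¹ with ht
  have hdecomp : uR Rd s t = (if t = 1 then 1 else 0) - mainKernel Rd s t := by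
    rw [← mainKernel_add_uR_eq_ite Rd t]; ring
  -- the indicator part
  have h1 : ‖(if t = 1 then (1 : ℂ) else 0)‖ ≤ (if (s : ℤ) ∣ k - c then 1 else 0 : ℝ) := by
    by_cases h : t = 1
    · have hkc : (c : ZMod s) = (k : ZMod s) := by
        have hu := ZMod.coe_int_inv_mul_eq_one (n := s) hsc.symm
        calc (c : ZMod s) = ((k : ZMod s) * ((c : ZMod s))⁻¹) * (c : ZMod s) := by
              rw [← ht, h, one_mul]
          _ = (k : ZMod s) := by rw [mul_assoc, hu, mul_one]
      have hdvd : (s : ℤ) ∣ k - c := (ZMod.intCast_eq_intCast_iff_dvd_sub c k s).mp hkc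
      rw [if_pos h, if_pos hdvd, norm_one]
    · rw [if_neg h, norm_zero]; positivity
  -- the small-conductor part
  have h2 : ‖mainKernel Rd s t‖ ≤ Rd * ((Nat.divisors s).card : ℝ) ^ 2 / s := by
    unfold mainKernel
    rw [norm_mul, norm_inv, Complex.norm_natCast]
    have hsum : ‖∑ χ : DirichletCharacter ℂ s, (if (χ.conductor : ℝ) ≤ Rd then χ t else 0)‖ ≤
        (((Finset.univ : Finset (DirichletCharacter ℂ s)).filter
          (fun χ => (χ.conductor : ℝ) ≤ Rd)).card : ℝ) := by
      refine (norm_sum_le _ _).trans ?_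
      rw [natCast_card_filter]
      refine sum_le_sum fun χ _ => ?_
      split_ifs
      · exact χ.norm_le_one _
      · simp
    have hcard := card_filter_conductor_le (k := s) hs hRd
    have hφ := totient_inv_le s hs
    have hφ0 : (0 : ℝ) ≤ ((Nat.totient s : ℝ))⁻¹ := by positivity
    calc ((Nat.totient s : ℝ))⁻¹ * ‖∑ χ : DirichletCharacter ℂ s, (if (χ.conductor : ℝ) ≤ Rd then χ t else 0)‖
        ≤ (((Nat.divisors s).card : ℝ) / s) * (Rd * (Nat.divisors s).card) :=
          mul_le_mul hφ (hsum.trans hcard) (norm_nonneg _) (by positivity)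
      _ = Rd * ((Nat.divisors s).card : ℝ) ^ 2 / s := by ring
  calc ‖uR Rd s t‖ = ‖(if t = 1 then (1 : ℂ) else 0) - mainKernel Rd s t‖ := by rw [hdecomp]
    _ ≤ ‖(if t = 1 then (1 : ℂ) else 0)‖ + ‖mainKernel Rd s t‖ := norm_sub_le _ _
    _ ≤ _ := add_le_add h1 h2

/-- **The `s`-sum of the trivial bound**: for `Slo > 0`, `Rd ≥ 0`, `k − c ≥ 1`, a set `S` of
moduli `s ∈ (Slo, 2Slo]` coprime to `c`, and `τ(s) ≤ T` on `S`:
`∑_{s ∈ S} |𝔲_{Rd}(k c̄; s)| ≤ τ(k − c) + 2 Rd T²` (divisors of `k − c`, and `#S ≤ 2 Slo` terms each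
`≤ Rd T²/Slo`).  Applied with `S = sRange c q r Slo (2 Slo)`. [folklore] -/
theorem sum_norm_uR_le (c : ℤ) (S : Finset ℕ) {Slo Rd T : ℝ} (hSlo : 0 < Slo) (hRd : 0 ≤ Rd)
    (hS : S ⊆ Icc 1 ⌊2 * Slo⌋₊) (hmem : ∀ s ∈ S, Slo < (s : ℝ) ∧ IsCoprime (s : ℤ) c)
    (hT : ∀ s ∈ S, ((Nat.divisors s).card : ℝ) ≤ T) {k : ℤ} (hk : 1 ≤ k - c) :
    (∑ s ∈ S, ‖uR Rd s ((k : ZMod s) * ((c : ZMod s))⁻¹)‖) ≤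
      (Nat.divisors (k - c).toNat).card + 2 * Rd * T ^ 2 := by
  have hpt : ∀ s ∈ S, ‖uR Rd s ((k : ZMod s) * ((c : ZMod s))⁻¹)‖ ≤
      (if (s : ℤ) ∣ k - c then 1 else 0) + Rd * T ^ 2 / Slo := by
    intro s hs
    have hs0 : 0 < s := (mem_Icc.mp (hS hs)).1
    obtain ⟨hsS, hsc⟩ := hmem s hs
    refine (norm_uR_le hRd hs0 hsc k).trans (add_le_add le_rfl ?_)
    have hτ := hT s hs
    have hτ0 : (0 : ℝ) ≤ (Nat.divisors s).card := Nat.cast_nonneg _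
    rw [div_le_div_iff₀ (by exact_mod_cast hs0) hSlo]
    have : Rd * ((Nat.divisors s).card : ℝ) ^ 2 ≤ Rd * T ^ 2 := by
      refine mul_le_mul_of_nonneg_left ?_ hRd
      exact pow_le_pow_left₀ hτ0 hτ 2
    have hRT0 : 0 ≤ Rd * T ^ 2 := by positivity
    calc Rd * ((Nat.divisors s).card : ℝ) ^ 2 * Slo ≤ Rd * T ^ 2 * Slo :=
          mul_le_mul_of_nonneg_right this hSlo.le
      _ ≤ Rd * T ^ 2 * s := mul_le_mul_of_nonneg_left hsS.le hRT0
  refine (sum_le_sum hpt).trans ?_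
  rw [sum_add_distrib]
  refine add_le_add ?_ ?_
  · -- divisors of `k - c`
    rw [← natCast_card_filter]
    have hkc : ((k - c).toNat : ℤ) = k - c := Int.toNat_of_nonneg (by omega)
    have hkc0 : (k - c).toNat ≠ 0 := by omega
    have hsub : (S.filter fun s : ℕ => (s : ℤ) ∣ k - c) ⊆ Nat.divisors (k - c).toNat := by
      intro s hs
      rw [mem_filter] at hs
      rw [Nat.mem_divisors]
      refine ⟨?_, hkc0⟩
      rw [← Int.natCast_dvd_natCast, hkc]
      exact hs.2
    exact_mod_cast card_le_card hsub
  · -- at most `2 Slo` terms of size `Rd T² / Slo`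
    rw [sum_const, nsmul_eq_mul]
    have hcard : (S.card : ℝ) ≤ 2 * Slo := by
      calc (S.card : ℝ) ≤ ((Icc 1 ⌊2 * Slo⌋₊).card : ℝ) := by exact_mod_cast card_le_card hS
        _ = ⌊2 * Slo⌋₊ := by rw [Nat.card_Icc]; push_cast; ring
        _ ≤ 2 * Slo := Nat.floor_le (by linarith)
    have hRT : 0 ≤ Rd * T ^ 2 / Slo := by positivity
    calc (S.card : ℝ) * (Rd * T ^ 2 / Slo) ≤ (2 * Slo) * (Rd * T ^ 2 / Slo) :=
          mul_le_mul_of_nonneg_right hcard hRT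
      _ = 2 * Rd * T ^ 2 := by field_simp

/-! ### §3 Elementary counting and size lemmas -/

/-- `#{1 ≤ q ≤ ⌊y⌋} ≤ y` for `y ≥ 0`. [folklore] -/
theorem card_Icc_one_floor_le {y : ℝ} (hy : 0 ≤ y) : (#(Icc 1 ⌊y⌋₊) : ℝ) ≤ y := by
  rw [Nat.card_Icc, Nat.add_sub_cancel]
  exact Nat.floor_le hy

/-- `#{m ∼ M} ≤ 3M` for `M ≥ 1`. [folklore] -/
theorem card_dyadic_le_three_mul {M : ℝ} (hM : 1 ≤ M) : (#(BFI.dyadic M) : ℝ) ≤ 3 * M := by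
  calc (#(BFI.dyadic M) : ℝ) ≤ #(range (⌊2 * M⌋₊ + 1)) := by
        exact_mod_cast card_le_card (Finset.filter_subset _ _)
    _ = ⌊2 * M⌋₊ + 1 := by rw [card_range]; push_cast; ring
    _ ≤ 2 * M + 1 := by linarith [Nat.floor_le (by linarith : 0 ≤ 2 * M)]
    _ ≤ 3 * M := by linarith

/-- Elements of `m ∼ M` (`M ≥ 0`) satisfy `M < m ≤ 2M` and `m ≥ 1`. [folklore] -/
theorem mem_dyadic_bounds {M : ℝ} (hM : 0 ≤ M) {m : ℕ} (hm : m ∈ BFI.dyadic M) :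
    M < m ∧ (m : ℝ) ≤ 2 * M ∧ 1 ≤ m :=
  ⟨((BFI.mem_dyadic hM).1 hm).1, ((BFI.mem_dyadic hM).1 hm).2, BFI.pos_of_mem_dyadic hM hm⟩

/-- Twisting by an archimedean character does not increase the size: `|a · m^{iτ}| ≤ |a|`
(`|m^{iτ}| = 1` for `m ≥ 1`, and `0^{iτ} ∈ {0, 1}`). [folklore] -/
theorem norm_mul_cpow_le (a : ℂ) (m : ℕ) (τ : ℝ) :
    ‖a * (m : ℂ) ^ ((τ : ℂ) * Complex.I)‖ ≤ ‖a‖ := by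
  rw [norm_mul]
  refine mul_le_of_le_one_right (norm_nonneg _) ?_
  rcases eq_or_ne m 0 with rfl | hm
  · by_cases h : ((τ : ℂ) * Complex.I) = 0
    · rw [h, Complex.cpow_zero, norm_one]
    · rw [Nat.cast_zero, Complex.zero_cpow h, norm_zero]; exact zero_le_one
  · rw [Complex.norm_natCast_cpow_of_pos (Nat.pos_of_ne_zero hm)]
    simp

/-- **Divisor-bounded coefficients are `≪ X^ε`**: if `σ₀(n) ≤ Ca · n^{ε/(K+1)}` for all `n`, then
`|a| ≤ σ₀(m)^K`, `1 ≤ m ≤ X` give `|a| ≤ Ca^K X^ε`. [folklore] -/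
theorem norm_le_of_divisor_bound {Ca K ε : ℝ} (hCa : 1 ≤ Ca) (hK : 0 ≤ K) (hε : 0 ≤ ε)
    (hσ : ∀ n : ℕ, ((σ 0 n : ℕ) : ℝ) ≤ Ca * (n : ℝ) ^ (ε / (K + 1))) {a : ℂ} {m : ℕ} (hm : 1 ≤ m)
    (ha : ‖a‖ ≤ ((σ 0 m : ℕ) : ℝ) ^ K) {X : ℝ} (hmX : (m : ℝ) ≤ X) : ‖a‖ ≤ Ca ^ K * X ^ ε := by
  have hm0 : (0 : ℝ) ≤ m := Nat.cast_nonneg _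
  have hm1 : (1 : ℝ) ≤ m := by exact_mod_cast hm
  have hK1 : 0 < K + 1 := by linarith
  calc ‖a‖ ≤ ((σ 0 m : ℕ) : ℝ) ^ K := ha
    _ ≤ (Ca * (m : ℝ) ^ (ε / (K + 1))) ^ K := Real.rpow_le_rpow (Nat.cast_nonneg _) (hσ m) hK
    _ = Ca ^ K * (m : ℝ) ^ (ε / (K + 1) * K) := by
        rw [Real.mul_rpow (by linarith) (Real.rpow_nonneg hm0 _), ← Real.rpow_mul hm0]
    _ ≤ Ca ^ K * (m : ℝ) ^ ε := by
        refine mul_le_mul_of_nonneg_left (Real.rpow_le_rpow_of_exponent_le hm1 ?_)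
          (Real.rpow_nonneg (by linarith) _)
        rw [div_mul_eq_mul_div, div_le_iff₀ hK1]
        nlinarith
    _ ≤ Ca ^ K * X ^ ε :=
        mul_le_mul_of_nonneg_left (Real.rpow_le_rpow hm0 hmX hε) (Real.rpow_nonneg (by linarith) _)

/-- Summing a decreasing majorant over `m ∼ M` (`M ≥ 1`): `∑_{m ∼ M} (W/m + 2) ≤ 3M (W/M + 2)` for
`W ≥ 0`. [folklore] -/
theorem sum_dyadic_div_add_two_le {M W : ℝ} (hM : 1 ≤ M) (hW : 0 ≤ W) :
    (∑ m ∈ BFI.dyadic M, (W / m + 2)) ≤ 3 * M * (W / M + 2) := by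
  have hM0 : 0 < M := by linarith
  have hpt : ∀ m ∈ BFI.dyadic M, W / m + 2 ≤ W / M + 2 := by
    intro m hm
    obtain ⟨hMm, -, -⟩ := mem_dyadic_bounds hM0.le hm
    have : W / m ≤ W / M := div_le_div_of_nonneg_left hW hM0 hMm.le
    linarith
  calc (∑ m ∈ BFI.dyadic M, (W / m + 2)) ≤ ∑ m ∈ BFI.dyadic M, (W / M + 2) := sum_le_sum hpt
    _ = #(BFI.dyadic M) * (W / M + 2) := by rw [sum_const, nsmul_eq_mul]
    _ ≤ 3 * M * (W / M + 2) :=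
        mul_le_mul_of_nonneg_right (card_dyadic_le_three_mul hM) (by positivity)

/-! ### Anchor -/

/-- Anchor of this support file (arithmetic tools) in the registered skeleton of `stmt-Parity-14272`
(line `peel-to-drappeau`, stub `stub_window`, window chain file 2/2). [this line] -/
theorem windowChain2_anchor : True := trivial

end Summit.Parity.GeneralizedHardyLittlewood.Cruxes.TypeI2Dilated.PeelToDrappeau

end
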